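import Summits.QuantumFields.BalabanUV.Beta.RemainderExplicitHistoryHalfMomentWitness
import Summits.QuantumFields.BalabanUV.Beta.RemainderExplicitHistoryDiagonalCauchy

/-!
# RemainderExplicitHistoryDiagonalProfile — ROAD P3: THE ORDER-0 PROFILE FAMILY `β_{k+1} = b + Σ_{i≤k} ρ(k−i)·min(g_k, |g_k − g_i|)`
# MEETS NODE U2's NE4 AS TYPED IFF ITS PROFILE IS GEOMETRICALLY SMALL (`ρ(k+1)·γ ≤ cθ^k` — the scale shift is EXACTLY
# `ρ(k+1)·min(w_{k+1}, |w_{k+1} − w_0|)`), SO NEVER FOR A POLYNOMIAL PROFILE — AND YET ITS CONTINUUM COUPLING EXISTS AT EVERY SCALE, for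
# EVERY summable profile with `2(Σρ)γ < b`, by the diagonal summation of `RemainderExplicitHistoryDiagonalExistence`
# (station S-d4p3-g47-1, fourth file: X20 INFO-1 of the sibling co-owner typed, and answered on road P3's own family)

Cell `pub-balaban`, β-function sub-cell, BINDER row D4 «RemainderConst leaves for Bałaban's split» (`HOME/BINDER-OWNERS.md`; owner
lineage `b2b-balaban-beta-an4`; this file by co-owner #3 lineage `b2b-balaban-beta-d4-p3`, road P3 «the reduction road», generation 47,
station S-d4p3-g47-1, closing file; imports road P3's `RemainderExplicitHistoryHalfMomentWitness` (generation 44: the family, its order-0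
modulus `histLipschitz`, its floor `lower`, its runs `runs_exist`) and the station's `RemainderExplicitHistoryDiagonalCauchy` (hence
`…DiagonalExistence`)), β-FLOW
TEAM duty (1); FREEZE (0) honoured (def-free module in road P3's own `RemainderExplicit*` series; no leaf, no interface, no Literature
file).  SOURCE OF THE SHAPES ONLY: [Balaban1987RG1] (0.20) p. 256, (0.31) and Thm 2 p. 259, §1 p. 264, §5 p. 298.  Pure real analysis
about ONE explicit toy family (ours, not Bałaban's).

HONEST FRAMING (page 1 of everything the β sub-cell writes).  *"Discharging BetaPertH makes Bałaban's UV stability UNCONDITIONAL —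
a real constructive-QFT result; it is NOT the continuum limit and NOT the Clay problem."*  THIS FILE DISCHARGES NOTHING OF THE
KIND.  It closes station S-d4p3-g47-1 on road P3's own ORDER-0 PROFILE FAMILY (generation 44, `RemainderExplicitHistoryHalfMomentWitness`,
profile case `λ k i = ρ(k − i)`): the sibling co-owner's located distinction (journal [D4P2-G35-X20] INFO-1 — for this family
`β_{k+2}(w) − β_{k+1}(Fin.tail w) = ρ(k+1)·min(w_{k+1}, |w_{k+1} − w_0|)` EXACTLY, so `ScaleShiftRate c θ γ β` holds iff `ρ(k+1)·γ ≤ cθ^k`: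
GEOMETRIC profiles only; road P3's polynomial ∕ log-moment profiles do NOT meet NE4 as typed and their existence leg is NOT covered by
node U2 or by (E33)) is TYPED here (§1–§2), and ANSWERED (§3): for EVERY summable profile (`Σ_{a<n} ρ_a ≤ W`, `2Wγ < b`) the family's
continuum coupling EXISTS at every scale with the limit flow and logarithmic asymptotic freedom — by the DIAGONAL SUMMATION over the
cutoff (scale-shift profile `σ_k = ρ(k+1)γ`, memory profile `ρ_a + [a = 0]·W`), with NO geometric rate anywhere.  So for the order-0
profile families the census reads: NE4 as typed ⟺ geometric profile ⟹ K-uniform RATE (node U2 ∕ (E33)); summable profile ⟹ EXISTENCE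
(this station); the K-uniform two-loop ENVELOPE ⟺ `Σρ(a)√a < ∞` (generation 44).  Nothing of Bałaban's (1.22) is asserted or
constructed; `BetaFlowAsPrinted S` records a Markov β_n only ⇒ no junction of the as-printed interface changes; row D4 class UNCHANGED
(critical-path width 0; instance 0∕1; D4 DISCHARGE NO DATE); NOT B12 Thm 2, NOT BetaPertH, NOT continuum, NOT Clay.  HONEST DEPENDENCY:
continuum YM on T⁴ ⇐ BetaPertH ∧ nine spine estimates (0/9 proved); BetaPertH ⇐ (D1) ∧ (D4) ∧ CAP+tail; G-an2-4 gates asym, D1 and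
NE2/3/4.  ABSOLUTE RULE: nothing is cited as a fact.

WHAT IS PROVED ([folklore]; 0 sorry; 0 `def`; the family as the hypothesis `hβ` on an abstract `β : FlowStep.HBeta`, profile `ρ ≥ 0`).
* §1 THE SCALE SHIFT IS EXACT: **`scaleShift_eq`** (`β (k+1) w − β k (Fin.tail w) = ρ(k+1)·min(w_{k+1}, |w_{k+1} − w_0|)`: the stationary
  weights cancel, only the extra finest coupling is felt); `scaleShift_abs_le` (`≤ ρ(k+1)·γ` on the box: the family carries the scale-shift
  PROFILE `σ_k = ρ(k+1)γ`); `sum_sigma_le` (`Σ_{k<n} ρ(k+1)γ ≤ γW`); `sum_fin_profile_eq` (the `Fin`-row sums are the profile's partial sums).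
* §2 NE4 AS TYPED ⟺ GEOMETRIC: **`scaleShiftRate_iff`** (`ScaleShiftRate c θ γ β ↔ ∀ k, ρ(k+1)·γ ≤ cθ^k`; ⇒: test histories
  `(ε, γ, …, γ)`, `ε ↓ 0`); `poly_not_geom` (`M∕(a+1)^p ≤ Cθ^a` fails for some `a` when `M > 0`, `0 ≤ θ < 1`);
  **`not_scaleShiftRate_poly`** (polynomial profile `ρ_a = M∕(a+1)^p` ⇒ `¬ ScaleShiftRate c θ γ β` for EVERY `c` and every `θ < 1`);
  `not_fadingMemory_poly` (its order-0 modulus `Λ k i = ρ(k−i) + [i = k]·W` has no `FadingMemory C θ` either).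
* §3 EXISTENCE ALL THE SAME: `modulus_le_profile` (`Λ k i ≤ ρ̃(k − i)`, `ρ̃_a = ρ_a + [a = 0]·W`, `Σ_{a<n} ρ̃_a ≤ 2W`);
  **`sum_disc_le_orderZero`** (for every family of runs of THIS β pinned at one `g_IR`: `Σ_{n<N} disc ≤ m·γW∕(1 − 2Wγ∕b)`);
  **`continuum_orderZero`** (`invSq g m n → astar g m`, couplings → `gstar g m ∈ ]0,γ]`, `gstar g 0 = g_IR`, limit flow with `b ≤ bstar`,
  `gstar_m ≤ 1∕√(1∕g_IR² + b·m)`); **`cauchySum_orderZero`** (node U6's Cauchy sum for the family: summable transported totals and uniform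
  convergence of the generating functions, given node U5's `MatchingModConstants`); `runFamily_exists` (such families exist for every
  `g_IR ∈ ]0,γ]`, `runs_exist` BY NAME + choice);
  END **`existence_without_NE4`**: for the polynomial profile, NO `c, θ < 1` give NE4 as typed, no `C, θ < 1` give fading memory, and the
  continuum coupling of every pinned family of runs exists at every scale.
-/

noncomputable section

open Finset Filter Topology

namespace Summit.QuantumFields.BalabanUV.Beta.RemainderExplicitHistoryDiagonalProfile

open Literature.MathematicalPhysics.QuantumFieldTheory.Balaban1983to89
open Literature.MathematicalPhysics.QuantumFieldTheory.Balaban1983to89.FlowStep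
open Literature.MathematicalPhysics.QuantumFieldTheory.Balaban1983to89.T4CouplingMatching
open Literature.MathematicalPhysics.QuantumFieldTheory.Balaban1983to89.T4ContinuumCoupling
open Summit.QuantumFields.BalabanUV.Beta.RemainderExplicitHistoryDiagonalExistence
open Summit.QuantumFields.BalabanUV.Beta.RemainderExplicitHistoryDiagonalCauchy (cauchySum_of_diag_le sum_pow_mul_linear_le)
open Literature.MathematicalPhysics.QuantumFieldTheory.Balaban1983to89.T4CauchySum (delta MatchingModConstants genFun genFunLim)

variable {β : HBeta} {b γ W : ℝ} {ρ : ℕ → ℝ}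

/-! ## §1 The scale shift of the order-0 profile family is exact -/

/-- **THE SCALE SHIFT IS EXACT** (X20 INFO-1 of the sibling co-owner, kernel-checked): for `β_{k+1}(p) = b + Σ_{i≤k} ρ(k−i)·min(p_k, |p_k − p_i|)`,
`β_{k+2}(w) − β_{k+1}(Fin.tail w) = ρ(k+1)·min(w_{k+1}, |w_{k+1} − w_0|)` — the stationary weights of the common couplings cancel and only
the extra FINEST coupling `w_0`, at age `k + 1`, is felt. [cite: Balaban1987RG1, §5 p.298] -/
theorem scaleShift_eq
    (hβ : ∀ (k : ℕ) (p : Fin (k + 1) → ℝ),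
      β k p = b + ∑ i : Fin (k + 1), ρ (k - i) * min (p (Fin.last k)) (|p (Fin.last k) - p i|))
    (k : ℕ) (w : Fin (k + 2) → ℝ) :
    β (k + 1) w - β k (Fin.tail w)
      = ρ (k + 1) * min (w (Fin.last (k + 1))) (|w (Fin.last (k + 1)) - w 0|) := by
  rw [hβ (k + 1) w, hβ k (Fin.tail w), Fin.sum_univ_succ]
  have e : ∀ i : Fin (k + 1),
      ρ (k + 1 - ((Fin.succ i : Fin (k + 2)) : ℕ)) * min (w (Fin.last (k + 1))) (|w (Fin.last (k + 1)) - w i.succ|)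
        = ρ (k - (i : ℕ)) * min (Fin.tail w (Fin.last k)) (|Fin.tail w (Fin.last k) - Fin.tail w i|) := by
    intro i
    simp only [Fin.tail, Fin.succ_last, Fin.val_succ, Nat.add_sub_add_right]
  simp only [e, Fin.val_zero, Nat.sub_zero]
  ring

/-- On the box the scale shift is at most `ρ(k+1)·γ` (`0 ≤ min(w_{k+1}, ·) ≤ w_{k+1} ≤ γ`): the family carries the SCALE-SHIFT PROFILE
`σ_k = ρ(k+1)·γ` of `RemainderExplicitHistoryDiagonalSum`. [folklore] -/
theorem scaleShift_abs_le
    (hβ : ∀ (k : ℕ) (p : Fin (k + 1) → ℝ),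
      β k p = b + ∑ i : Fin (k + 1), ρ (k - i) * min (p (Fin.last k)) (|p (Fin.last k) - p i|))
    (hρ0 : ∀ a, 0 ≤ ρ a) :
    ∀ k (w : Fin (k + 2) → ℝ), w ∈ Box γ (k + 1) →
      |β (k + 1) w - β k (Fin.tail w)| ≤ (fun k => ρ (k + 1) * γ) k := by
  intro k w hw
  rw [scaleShift_eq hβ k w]
  have hl := mem_box.mp hw (Fin.last (k + 1))
  have hmin0 : 0 ≤ min (w (Fin.last (k + 1))) (|w (Fin.last (k + 1)) - w 0|) := le_min hl.1.le (abs_nonneg _)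
  have hminγ : min (w (Fin.last (k + 1))) (|w (Fin.last (k + 1)) - w 0|) ≤ γ := (min_le_left _ _).trans hl.2
  rw [abs_of_nonneg (mul_nonneg (hρ0 _) hmin0)]
  exact mul_le_mul_of_nonneg_left hminγ (hρ0 _)

/-- Partial sums of the scale-shift profile: `Σ_{k<n} ρ(k+1)·γ ≤ γ·W` when `Σ_{a<n} ρ_a ≤ W` for all `n` (`γ ≥ 0`). [folklore] -/
theorem sum_sigma_le (hρ0 : ∀ a, 0 ≤ ρ a) (hρW : ∀ n, ∑ a ∈ range n, ρ a ≤ W) (hγ : 0 ≤ γ) (n : ℕ) :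
    ∑ k ∈ range n, ρ (k + 1) * γ ≤ γ * W := by
  rw [← Finset.sum_mul, mul_comm]
  refine mul_le_mul_of_nonneg_left ?_ hγ
  have h := hρW (n + 1)
  rw [Finset.sum_range_succ'] at h
  linarith [hρ0 0]

/-- The `Fin`-row sums of the stationary weights are the profile's partial sums: `Σ_{i : Fin (k+1)} ρ(k − i) = Σ_{a<k+1} ρ_a`. [folklore] -/
theorem sum_fin_profile_eq (k : ℕ) : ∑ i : Fin (k + 1), ρ (k - i) = ∑ a ∈ range (k + 1), ρ a := by
  rw [Fin.sum_univ_eq_sum_range (fun i => ρ (k - i)) (k + 1), ← Finset.sum_range_reflect (fun a => ρ a) (k + 1)]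
  exact Finset.sum_congr rfl fun i _ => by rw [Nat.add_sub_cancel]

/-! ## §2 NE4 as typed ⟺ the profile is geometrically small; never for a polynomial profile -/

/-- **NE4 AS TYPED ⟺ GEOMETRIC PROFILE**: for the order-0 profile family (`ρ ≥ 0`, `γ > 0`),
`ScaleShiftRate c θ γ β ↔ ∀ k, ρ(k+1)·γ ≤ c·θ^k`.  (⇐) by `scaleShift_abs_le`; (⇒) test the rate on the histories `(ε, γ, …, γ)`: the shift is
`ρ(k+1)(γ − ε)` there, and `ε ↓ 0`. [folklore] -/
theorem scaleShiftRate_iff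
    (hβ : ∀ (k : ℕ) (p : Fin (k + 1) → ℝ),
      β k p = b + ∑ i : Fin (k + 1), ρ (k - i) * min (p (Fin.last k)) (|p (Fin.last k) - p i|))
    (hρ0 : ∀ a, 0 ≤ ρ a) (hγ : 0 < γ) {c θ : ℝ} :
    ScaleShiftRate c θ γ β ↔ ∀ k, ρ (k + 1) * γ ≤ c * θ ^ k := by
  constructor
  · intro h k
    refine le_of_forall_pos_lt_add fun η hη => ?_
    set r := ρ (k + 1) with hr
    have hr0 : 0 ≤ r := hρ0 _
    set ε : ℝ := min (γ / 2) (η / (2 * (r + 1))) with hε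
    have hε0 : 0 < ε := lt_min (by linarith) (by positivity)
    have hεγ : ε < γ := (min_le_left _ _).trans_lt (by linarith)
    have hεη : r * ε < η := by
      have h1 : ε ≤ η / (2 * (r + 1)) := min_le_right _ _
      have h2 : r * ε ≤ r * (η / (2 * (r + 1))) := mul_le_mul_of_nonneg_left h1 hr0
      have h3 : r * (η / (2 * (r + 1))) < η := by
        rw [mul_div_assoc', div_lt_iff₀ (by positivity)]
        nlinarith
      linarith
    let w : Fin (k + 2) → ℝ := fun i => if (i : ℕ) = 0 then ε else γ
    have hw : w ∈ Box γ (k + 1) := mem_box.mpr fun i => by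
      by_cases hi : (i : ℕ) = 0
      · simp only [w, hi, if_true]; exact ⟨hε0, hεγ.le⟩
      · simp only [w, hi, if_false]; exact ⟨hγ, le_rfl⟩
    have hlast : w (Fin.last (k + 1)) = γ := by simp [w]
    have h0 : w 0 = ε := by simp [w]
    have h1 := h k w hw
    rw [scaleShift_eq hβ k w, hlast, h0, abs_of_pos (by linarith : 0 < γ - ε),
      min_eq_right (by linarith : γ - ε ≤ γ)] at h1
    have h2 : r * (γ - ε) ≤ c * θ ^ k := (le_abs_self _).trans h1
    nlinarith
  · intro h k w hw
    exact (scaleShift_abs_le hβ hρ0 k w hw).trans (h k)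

/-- A POLYNOMIAL IS NOT GEOMETRICALLY SMALL: for `M > 0`, `0 ≤ θ < 1`, any `C` and `p`, some `a` has `C·θ^a < M∕(a+1)^p`
(`n^p θ^n → 0`, `tendsto_pow_const_mul_const_pow_of_abs_lt_one`). [folklore] -/
theorem poly_not_geom {M C θ : ℝ} (hM : 0 < M) (hθ0 : 0 ≤ θ) (hθ1 : θ < 1) (p : ℕ) :
    ∃ a : ℕ, C * θ ^ a < M / ((a : ℝ) + 1) ^ p := by
  by_contra hcon
  simp only [not_exists, not_lt] at hcon
  -- `C ≥ M > 0` from `a = 0`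
  have hC : M ≤ C := by simpa using hcon 0
  have hC0 : 0 ≤ C := hM.le.trans hC
  -- `C·2^p·(n^p θ^n) → 0`, so eventually `< M`
  have ht := (tendsto_pow_const_mul_const_pow_of_abs_lt_one p (abs_lt.mpr ⟨by linarith, hθ1⟩)).const_mul (C * 2 ^ p)
  rw [mul_zero] at ht
  obtain ⟨N, hN⟩ := (ht.eventually (gt_mem_nhds hM)).exists_forall_of_atTop
  have hn := hN (N + 1) (Nat.le_succ N)
  have ha := hcon (N + 1)
  -- `M ≤ C θ^a (a+1)^p ≤ C 2^p a^p θ^a` for `a = N + 1 ≥ 1`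
  have hpos : (0 : ℝ) < ((N + 1 : ℕ) : ℝ) + 1 := by positivity
  rw [div_le_iff₀ (pow_pos hpos p)] at ha
  have hle : (((N + 1 : ℕ) : ℝ) + 1) ^ p ≤ (2 : ℝ) ^ p * ((N + 1 : ℕ) : ℝ) ^ p := by
    rw [← mul_pow]
    exact pow_le_pow_left₀ hpos.le (by push_cast; linarith) p
  have hθa : 0 ≤ C * θ ^ (N + 1) := mul_nonneg hC0 (pow_nonneg hθ0 _)
  have : M ≤ C * 2 ^ p * (((N + 1 : ℕ) : ℝ) ^ p * θ ^ (N + 1)) := by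
    calc M ≤ C * θ ^ (N + 1) * ((((N + 1 : ℕ) : ℝ) + 1) ^ p) := ha
      _ ≤ C * θ ^ (N + 1) * ((2 : ℝ) ^ p * ((N + 1 : ℕ) : ℝ) ^ p) := mul_le_mul_of_nonneg_left hle hθa
      _ = C * 2 ^ p * (((N + 1 : ℕ) : ℝ) ^ p * θ ^ (N + 1)) := by ring
  linarith

/-- **ROAD P3's POLYNOMIAL PROFILES NEVER MEET NE4 AS TYPED**: for `ρ_a = M∕(a+1)^p` (`M > 0`), `γ > 0`, `0 ≤ θ < 1` and EVERY `c`,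
`¬ ScaleShiftRate c θ γ β`. [folklore] -/
theorem not_scaleShiftRate_poly
    (hβ : ∀ (k : ℕ) (p : Fin (k + 1) → ℝ),
      β k p = b + ∑ i : Fin (k + 1), ρ (k - i) * min (p (Fin.last k)) (|p (Fin.last k) - p i|))
    {M : ℝ} {p : ℕ} (hM : 0 < M) (hρ : ∀ a, ρ a = M / ((a : ℝ) + 1) ^ p) (hγ : 0 < γ)
    {c θ : ℝ} (hθ0 : 0 ≤ θ) (hθ1 : θ < 1) : ¬ ScaleShiftRate c θ γ β := by
  have hρ0 : ∀ a, 0 ≤ ρ a := fun a => by rw [hρ a]; positivity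
  rw [scaleShiftRate_iff hβ hρ0 hγ]
  intro h
  -- `ρ(k+1)γ = Mγ∕(k+2)^p ≥ (Mγ∕2^p)∕(k+1)^p`, against `c θ^k`
  obtain ⟨a, ha⟩ := poly_not_geom (M := M * γ / 2 ^ p) (C := c) (by positivity) hθ0 hθ1 p
  have hk := h a
  rw [hρ (a + 1)] at hk
  have hpos : (0 : ℝ) < (a : ℝ) + 1 := by positivity
  have hcmp : M * γ / 2 ^ p / ((a : ℝ) + 1) ^ p ≤ M / (((a + 1 : ℕ) : ℝ) + 1) ^ p * γ := by
    have h2 : (((a + 1 : ℕ) : ℝ) + 1) ^ p ≤ (2 : ℝ) ^ p * ((a : ℝ) + 1) ^ p := by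
      rw [← mul_pow]
      exact pow_le_pow_left₀ (by positivity) (by push_cast; linarith) p
    have h3 : (0 : ℝ) < (((a + 1 : ℕ) : ℝ) + 1) ^ p := by positivity
    calc M * γ / 2 ^ p / ((a : ℝ) + 1) ^ p = (M * γ) / ((2 : ℝ) ^ p * ((a : ℝ) + 1) ^ p) := by rw [div_div]
      _ ≤ (M * γ) / (((a + 1 : ℕ) : ℝ) + 1) ^ p := div_le_div_of_nonneg_left (by positivity) h3 h2
      _ = M / (((a + 1 : ℕ) : ℝ) + 1) ^ p * γ := by ring
  linarith

/-- … NOR DO THEY HAVE FADING MEMORY: the family's order-0 modulus `Λ k i = ρ(k − i) + [i = k]·W` (`histLipschitz`, generation 44) admits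
no `FadingMemory C θ Λ` with `θ < 1` for the polynomial profile (`Λ a 0 = ρ_a` for `a ≥ 1`). [folklore] -/
theorem not_fadingMemory_poly {M : ℝ} {p : ℕ} (hM : 0 < M) (hρ : ∀ a, ρ a = M / ((a : ℝ) + 1) ^ p) (hW : 0 ≤ W)
    {C θ : ℝ} (hθ0 : 0 ≤ θ) (hθ1 : θ < 1) :
    ¬ FadingMemory C θ (fun k i => ρ (k - i) + if i = k then W else 0) := by
  intro h
  obtain ⟨a, ha⟩ := poly_not_geom (M := M) (C := C) hM hθ0 hθ1 p
  have h1 := (h a 0 (Nat.zero_le a)).2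
  simp only [Nat.sub_zero] at h1
  have h2 : ρ a ≤ C * θ ^ a := by
    by_cases h0 : (0 : ℕ) = a
    · rw [if_pos h0] at h1; linarith
    · rw [if_neg h0, add_zero] at h1; exact h1
  rw [hρ a] at h2
  linarith

/-! ## §3 Existence all the same: the diagonal summation applies to every summable profile -/

/-- The family's order-0 modulus is dominated by the memory PROFILE `ρ̃_a = ρ_a + [a = 0]·W`, whose partial sums are `≤ 2W`. [folklore] -/
theorem modulus_le_profile (hρ0 : ∀ a, 0 ≤ ρ a) (hρW : ∀ n, ∑ a ∈ range n, ρ a ≤ W) :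
    (∀ k i, i ≤ k → 0 ≤ ρ (k - i) + (if i = k then W else 0)) ∧
    (∀ k i, i ≤ k → ρ (k - i) + (if i = k then W else 0) ≤ (fun a => ρ a + if a = 0 then W else 0) (k - i)) ∧
    (∀ a, 0 ≤ ρ a + (if a = 0 then W else 0)) ∧
    (∀ n, ∑ a ∈ range n, (ρ a + if a = 0 then W else 0) ≤ 2 * W) := by
  have hW : 0 ≤ W := by simpa using hρW 0
  refine ⟨fun k i _ => add_nonneg (hρ0 _) (by split_ifs <;> linarith), fun k i hi => ?_,
    fun a => add_nonneg (hρ0 _) (by split_ifs <;> linarith), fun n => ?_⟩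
  · have hiff : i = k ↔ k - i = 0 := by omega
    simp only [hiff]
    exact le_rfl
  · rw [Finset.sum_add_distrib]
    have h1 := hρW n
    have h2 : ∑ a ∈ range n, (if a = 0 then W else (0 : ℝ)) ≤ W := by
      rw [Finset.sum_ite_eq']
      split_ifs <;> linarith
    linarith

/-- **ROAD P3 — THE ORDER-0 PROFILE FAMILY's MATCHING DISCREPANCIES ARE SUMMABLE OVER THE CUTOFF, FOR EVERY SUMMABLE PROFILE**: for
`β_{k+1} = b + Σ_{i≤k} ρ(k−i)·min(g_k, |g_k − g_i|)` (`b > 0`, `ρ ≥ 0`, `Σ_{a<n} ρ_a ≤ W`, `2Wγ < b`) and EVERY family of runs of (0.20) of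
this `β` in ]0,γ] pinned at one `g_IR`: `Σ_{n<N} disc (g (n+m)) (g (n+m+1)) n ≤ m·(γW)∕(1 − 2W·γ∕b)` at every infrared distance `m` —
`RemainderExplicitHistoryDiagonalSum.sum_disc_diag_le` with `σ_k = ρ(k+1)γ` (§1), the generation-44 modulus `histLipschitz` dominated by
`ρ̃` (`modulus_le_profile`) and the floor `lower`.  NO NE4 as typed is available here for non-geometric `ρ` (§2). [cite: Balaban1987RG1, (0.20) p.256 and Thm 2 p.259] -/
theorem sum_disc_le_orderZero
    (hβ : ∀ (k : ℕ) (p : Fin (k + 1) → ℝ),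
      β k p = b + ∑ i : Fin (k + 1), ρ (k - i) * min (p (Fin.last k)) (|p (Fin.last k) - p i|))
    (hb : 0 < b) (hγ : 0 < γ) (hρ0 : ∀ a, 0 ≤ ρ a) (hρW : ∀ n, ∑ a ∈ range n, ρ a ≤ W) (hsmall : 2 * W * γ < b)
    {g : ℕ → ℕ → ℝ} {gIR : ℝ} (hrun : ∀ K, RGEqH K β (g K)) (hbox : ∀ K i, i ≤ K → 0 < g K i ∧ g K i ≤ γ)
    (hpin : ∀ K, g K K = gIR) (m N : ℕ) :
    ∑ n ∈ range N, disc (g (n + m)) (g (n + m + 1)) n ≤ (m : ℝ) * (γ * W) / (1 - 2 * W * γ / b) := by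
  obtain ⟨hΛ0, hΛρ, hρt0, hρtW⟩ := modulus_le_profile hρ0 hρW
  have hlamW : ∀ k, ∑ i : Fin (k + 1), (fun k i => ρ (k - i)) k i ≤ W := fun k => by
    simpa [sum_fin_profile_eq] using hρW (k + 1)
  have hL := RemainderExplicitHistoryHalfMomentWitness.histLipschitz (γ := γ) (lam := fun k i => ρ (k - i)) hβ (fun k i => hρ0 _)
    hlamW
  have hlo : BetaLowerH b γ β :=
    RemainderExplicitHistoryHalfMomentWitness.lower (γ := γ) (lam := fun k i => ρ (k - i)) hβ (fun k i => hρ0 _)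
  exact RemainderExplicitHistoryDiagonalSum.sum_disc_diag_le g gIR hγ hb (fun l => mul_nonneg (hρ0 _) hγ.le) hρt0
    (sum_sigma_le hρ0 hρW hγ.le) hρtW hsmall hrun hbox hpin (scaleShift_abs_le hβ hρ0) hL hΛ0 hΛρ hlo m N

/-- **ROAD P3 — THE CONTINUUM COUPLING OF THE ORDER-0 PROFILE FAMILY EXISTS AT EVERY SCALE, FOR EVERY SUMMABLE PROFILE** (no NE4 as typed,
no fading memory): `invSq g m n → astar g m` with `|invSq g m n − astar g m| ≤ m·γW∕(1 − 2Wγ∕b)`, the couplings converge to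
`gstar g m ∈ ]0,γ]` with `gstar g 0 = g_IR`, the diagonal β-values converge to `bstar g m ≥ b`, the limit flow
`1∕gstar_{m+1}² = 1∕gstar_m² + bstar_m` holds and `gstar_m ≤ 1∕√(1∕g_IR² + b·m)`. [cite: Balaban1987RG1, (0.20) p.256, (0.31) and Thm 2 p.259] -/
theorem continuum_orderZero
    (hβ : ∀ (k : ℕ) (p : Fin (k + 1) → ℝ),
      β k p = b + ∑ i : Fin (k + 1), ρ (k - i) * min (p (Fin.last k)) (|p (Fin.last k) - p i|))
    (hb : 0 < b) (hγ : 0 < γ) (hρ0 : ∀ a, 0 ≤ ρ a) (hρW : ∀ n, ∑ a ∈ range n, ρ a ≤ W) (hsmall : 2 * W * γ < b)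
    {g : ℕ → ℕ → ℝ} {gIR : ℝ} (hrun : ∀ K, RGEqH K β (g K)) (hbox : ∀ K i, i ≤ K → 0 < g K i ∧ g K i ≤ γ)
    (hpin : ∀ K, g K K = gIR) :
    (∀ m, Tendsto (invSq g m) atTop (𝓝 (astar g m)))
      ∧ (∀ m n, |invSq g m n - astar g m| ≤ (m : ℝ) * (γ * W) / (1 - 2 * W * γ / b))
      ∧ (∀ m, Tendsto (fun n => g (n + m) n) atTop (𝓝 (gstar g m))) ∧ (∀ m, 0 < gstar g m ∧ gstar g m ≤ γ) ∧ gstar g 0 = gIR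
      ∧ (∀ m, Tendsto (fun n => β n (prefixOf (g (n + m + 1)) n)) atTop (𝓝 (bstar g m)))
      ∧ (∀ m, 1 / (gstar g (m + 1)) ^ 2 = 1 / (gstar g m) ^ 2 + bstar g m) ∧ (∀ m, b ≤ bstar g m)
      ∧ (∀ m, gstar g m ≤ 1 / sprof gIR b m) := by
  have hB := sum_disc_le_orderZero hβ hb hγ hρ0 hρW hsmall hrun hbox hpin
  have hlo : BetaLowerH b γ β :=
    RemainderExplicitHistoryHalfMomentWitness.lower (γ := γ) (lam := fun k i => ρ (k - i)) hβ (fun k i => hρ0 _)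
  exact ⟨tendsto_invSq_of_diag_le hB, abs_invSq_sub_astar_le_of_diag_le hB, tendsto_coupling_of_diag_le hB hbox,
    fun m => ⟨(gstar_pos_le_of_diag_le hB hbox m).1, (gstar_pos_le_of_diag_le hB hbox m).2.1⟩,
    gstar_zero_of_diag_le hB hbox hpin, tendsto_beta_diag_of_diag_le hB hrun, gstar_flow_of_diag_le hB hbox,
    le_bstar_of_diag_le hB hrun hbox hlo, fun m => (gstar_le_inv_sprof_of_diag_le hB hrun hbox hpin hlo hb.le m).2⟩

/-- **ROAD P3 — NODE U6's CAUCHY SUM FOR THE ORDER-0 PROFILE FAMILY, FOR EVERY SUMMABLE PROFILE** (no NE4 as typed, no fading memory):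
with a transport contraction `0 ≤ ρ₁ < 1`, `E ≥ 0` and node U5's `MatchingModConstants vol l₀ (delta E ρ₁ disc) Z`, the transported totals are
summable and the generating functions `genFun Z K` converge uniformly on `|t| ≤ l₀` to `genFunLim Z`
(`RemainderExplicitHistoryDiagonalCauchy.cauchySum_of_diag_le` on `sum_disc_le_orderZero`; the linear diagonal bound against `Σ_m m·ρ₁^m < ∞`).
[cite: King1986, Thm 3.4 p.656] -/
theorem cauchySum_orderZero
    (hβ : ∀ (k : ℕ) (p : Fin (k + 1) → ℝ),
      β k p = b + ∑ i : Fin (k + 1), ρ (k - i) * min (p (Fin.last k)) (|p (Fin.last k) - p i|))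
    (hb : 0 < b) (hγ : 0 < γ) (hρ0 : ∀ a, 0 ≤ ρ a) (hρW : ∀ n, ∑ a ∈ range n, ρ a ≤ W) (hsmall : 2 * W * γ < b)
    {g : ℕ → ℕ → ℝ} {gIR : ℝ} (hrun : ∀ K, RGEqH K β (g K)) (hbox : ∀ K i, i ≤ K → 0 < g K i ∧ g K i ≤ γ)
    (hpin : ∀ K, g K K = gIR) {E ρ₁ vol l₀ : ℝ} {Z : ℕ → ℝ → ℝ} (hE : 0 ≤ E) (hρ₁0 : 0 ≤ ρ₁) (hρ₁1 : ρ₁ < 1) (hl₀ : 0 ≤ l₀)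
    (hU5 : MatchingModConstants vol l₀ (delta E ρ₁ (fun K j => disc (g K) (g (K + 1)) j)) Z) :
    Summable (delta E ρ₁ (fun K j => disc (g K) (g (K + 1)) j)) ∧
    (∀ K : ℕ, ∀ t : ℝ, |t| ≤ l₀ →
      |genFun Z (K + 1) t - genFun Z K t| ≤ 2 * (vol * delta E ρ₁ (fun K j => disc (g K) (g (K + 1)) j) K)) ∧
    (∀ t : ℝ, |t| ≤ l₀ → CauchySeq fun K => genFun Z K t) ∧
    TendstoUniformlyOn (fun K t => genFun Z K t) (genFunLim Z) atTop {t | |t| ≤ l₀} := by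
  have hB := sum_disc_le_orderZero hβ hb hγ hρ0 hρW hsmall hrun hbox hpin
  have hW : 0 ≤ W := by simpa using hρW 0
  have hq : 0 < 1 - 2 * W * γ / b := by
    have : 2 * W * γ / b < 1 := by rw [div_lt_one hb]; exact hsmall
    linarith
  have hC : 0 ≤ γ * W / (1 - 2 * W * γ / b) := div_nonneg (mul_nonneg hγ.le hW) hq.le
  refine cauchySum_of_diag_le (B := fun m => (m : ℝ) * (γ * W) / (1 - 2 * W * γ / b)) hE hρ₁0 hl₀ hB
    (T := γ * W / (1 - 2 * W * γ / b) * ∑' n : ℕ, ((n : ℝ) + 1) ^ 1 * ρ₁ ^ n) (fun L => ?_) hU5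
  have h := sum_pow_mul_linear_le (C := γ * W / (1 - 2 * W * γ / b)) hρ₁0 hρ₁1 hC L
  refine le_trans (le_of_eq (Finset.sum_congr rfl fun m _ => ?_)) h
  ring

/-- NON-VACUITY: for every renormalized `g_IR ∈ ]0,γ]` a family of runs of this `β` — `K` steps, in the box, pinned `g K K = g_IR` — EXISTS
(`runs_exist`, generation 44, BY NAME for each `K`, and choice). [cite: Balaban1987RG1, Thm 2 p.259] -/
theorem runFamily_exists
    (hβ : ∀ (k : ℕ) (p : Fin (k + 1) → ℝ),
      β k p = b + ∑ i : Fin (k + 1), ρ (k - i) * min (p (Fin.last k)) (|p (Fin.last k) - p i|))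
    (hb : 0 < b) (hγ : 0 < γ) (hρ0 : ∀ a, 0 ≤ ρ a) (hρW : ∀ n, ∑ a ∈ range n, ρ a ≤ W) (hsmall : 2 * W * γ ≤ b)
    {gIR : ℝ} (hgIR : 0 < gIR) (hgIRγ : gIR ≤ γ) :
    ∃ g : ℕ → ℕ → ℝ, (∀ K, RGEqH K β (g K)) ∧ (∀ K i, i ≤ K → 0 < g K i ∧ g K i ≤ γ) ∧ ∀ K, g K K = gIR := by
  have hlamW : ∀ k, ∑ i : Fin (k + 1), (fun k i => ρ (k - i)) k i ≤ W := fun k => by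
    simpa [sum_fin_profile_eq] using hρW (k + 1)
  have h := fun K => RemainderExplicitHistoryHalfMomentWitness.runs_exist (lam := fun k i => ρ (k - i)) hβ hb
    (fun k i => hρ0 _) hlamW hγ hsmall K hgIR hgIRγ
  choose g hg using h
  exact ⟨g, fun K => (hg K).2.1, fun K => (hg K).2.2, fun K => (hg K).1⟩

/-- **END — EXISTENCE WITHOUT NE4 AS TYPED.**  For road P3's order-0 family with a POLYNOMIAL profile `ρ_a = M∕(a+1)^p` (`M > 0`,
`Σ_{a<n} ρ_a ≤ W`, `2Wγ < b`): (i) NO constants `c`, `0 ≤ θ < 1` give node U2's NE4 as typed `ScaleShiftRate c θ γ β`; (ii) NO `C`,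
`0 ≤ θ < 1` give `FadingMemory C θ` of its order-0 modulus; (iii) YET for every family of its runs pinned at one `g_IR` the recursion
variables converge at every scale, `invSq g m n → astar g m`, and the couplings converge to `gstar g m` — the located census distinction of
journal [D4P2-G35-X20] INFO-1 typed and settled on road P3's side: the geometric shapes buy the RATE, summability buys EXISTENCE. [folklore] -/
theorem existence_without_NE4
    (hβ : ∀ (k : ℕ) (p : Fin (k + 1) → ℝ),
      β k p = b + ∑ i : Fin (k + 1), ρ (k - i) * min (p (Fin.last k)) (|p (Fin.last k) - p i|))
    (hb : 0 < b) (hγ : 0 < γ) {M : ℝ} {p : ℕ} (hM : 0 < M) (hρ : ∀ a, ρ a = M / ((a : ℝ) + 1) ^ p)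
    (hρW : ∀ n, ∑ a ∈ range n, ρ a ≤ W) (hsmall : 2 * W * γ < b) :
    (∀ c θ : ℝ, 0 ≤ θ → θ < 1 → ¬ ScaleShiftRate c θ γ β)
      ∧ (∀ C θ : ℝ, 0 ≤ θ → θ < 1 → ¬ FadingMemory C θ (fun k i => ρ (k - i) + if i = k then W else 0))
      ∧ ∀ (g : ℕ → ℕ → ℝ) (gIR : ℝ), (∀ K, RGEqH K β (g K)) → (∀ K i, i ≤ K → 0 < g K i ∧ g K i ≤ γ) →
          (∀ K, g K K = gIR) →
            (∀ m, Tendsto (invSq g m) atTop (𝓝 (astar g m))) ∧ ∀ m, Tendsto (fun n => g (n + m) n) atTop (𝓝 (gstar g m)) := by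
  have hρ0 : ∀ a, 0 ≤ ρ a := fun a => by rw [hρ a]; positivity
  have hW : 0 ≤ W := by simpa using hρW 0
  refine ⟨fun c θ hθ0 hθ1 => not_scaleShiftRate_poly hβ hM hρ hγ hθ0 hθ1,
    fun C θ hθ0 hθ1 => not_fadingMemory_poly hM hρ hW hθ0 hθ1, fun g gIR hrun hbox hpin => ?_⟩
  have h := continuum_orderZero hβ hb hγ hρ0 hρW hsmall hrun hbox hpin
  exact ⟨h.1, h.2.2.1⟩

end Summit.QuantumFields.BalabanUV.Beta.RemainderExplicitHistoryDiagonalProfile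

end
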